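/-
Copyright (c) 2026 the pub-hodgecm-mathlib formalisation cell (harness21).  Prover seat hodgecm-mathlib-K2E4-p11 (g4), Track B ∕ K2-LIT, h413 =
`stmt-HodgeConjecture-24833`, line `K2_E1_TraceFormulaBeta`, campaign «EIS-RANK-ONE», rung R6h, deal «POLE-CONTROL-3-SPH ED. 2» of K2E1-plan (g4) 2026-09-04T07:17:02Z:
the spherical pole control of ★ p858209 with its decay survivors `hdec′` ∕ `hdecU` DISCHARGED by the z-uniform cusp bound ★ (R3u)₃ p858228 and the F-layer symbol bound ★ (q11) p858234.
-/
import Summits.HodgeConjecture.HodgeConjecture.Theorems.K2E1MaassSelbergPoleControlSphericalCMThree          -- ★ p858209 (K2E4-p10 (g4)): `poleControl_sphericalEisenstein_cm_three` (survivors `hdec′`∕`hdecU`)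
import Summits.HodgeConjecture.HodgeConjecture.Theorems.K2E1EisensteinMinusConstantTermBoundedCMThreeUniform  -- ★ (R3u)₃ p858228 (this seat): the z-uniform cusp bound
import Summits.HodgeConjecture.HodgeConjecture.Theorems.K2E1HeightLineArchSmoothUniformU3                    -- ★ (q11) p858234 (K2E4-p10 (g4)): `exists_archSmooth_flatSectionU_const_cm_three_uniform`
import Summits.HodgeConjecture.HodgeConjecture.Theorems.K2E1HeightLineArchSmoothU3E                        -- ★ (E-d) (this seat, ED. 3): `exists_archSmoothZ_flatSectionU_const_cm_three_uniform` — the payer of `hφarchZ`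
import HarnessLib

/-!
# h413 ∕ Track B «K2-LIT», «EIS-RANK-ONE» R6h — `K2E1MaassSelbergPoleControlSphericalCMThreeArch`: POLE CONTROL AT THE SPHERICAL VECTOR OF `U(2,1)` OVER A CM FIELD,
# EDITION 2 — the decay survivors `hdec′` ∕ `hdecU` of ★ p858209 DISCHARGED; survivor: the E-layer archimedean symbol binder `hφarchZ` only

Cell `pub/hodgecm-mathlib`, crux H413 = `stmt-HodgeConjecture-24833`, route `HCCMUnconditional`; dealer K2E1-plan (g4), deal «POLE-CONTROL-3-SPH ED. 2» 2026-09-04T07:17:02Z.  THEOREMS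
ONLY (no `def`, no `instance`, no `notation`, no named-fact hypothesis, no `sorry`); lane `--kind proof --supports stmt-HodgeConjecture-24833 --as helper` (count-neutral).
THE STEP ED. 1 → ED. 2.  ★ p858209 `poleControl_sphericalEisenstein_cm_three` (K2E4-p10 (g4)) controls the `c`-function of `U(2,1)` on the Godement half-plane modulo the decay of
`E(φ₀H^{z′}) − E(φ₀H^{z′})_B` on `{H > T}`, pointwise on the sub-tube (`hdec′`) and locally uniformly at `z` (`hdecU`).  Both are instances of ★ (R3u)₃
`exists_bound_sub_borelConstantTerm_level_cm_three_uniform_of_archSmooth` at the constant section `φ ≡ φ₀` on a compact `Kc ⊂ {2 < Re}`: `Kc = {z′}` for `hdec′`, `Kc = closedBall z r`,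
`r = (Re z − 2)∕2`, for `hdecU` (§2 `exists_bound_sub_borelConstantTerm_sphericalEisenstein_cm_three`).  Its binders at `φ ≡ φ₀`: `hf` is the Borel law of `φ₀·H^z` for the TRIVIAL
Hecke character (§1 `flatSectionU_const_borel_mul`), `hφc hφM hφB hφU` are trivial, the level is `U₀ = GL₃(𝒪̂_L)` (★ `isOpen_glFiniteIntegralLevel`), the F-layer archimedean binder is
★ (q11) `exists_archSmooth_flatSectionU_const_cm_three_uniform` on `‖z′‖ ≤ R ⊇ Kc`, and the E-layer one is the NAMED `hφarchZ` in the same `∀ R, ∃ C_φ, ∀ ‖z′‖ ≤ R` shape (ONE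
`C_φ := max C_F C_E` feeds ★ (R3u)₃; the weaker bounds by monotonicity, the centre line integrable ★ p858088).  The auxiliary Haar measures on `𝔸_L`, `𝔸_{L,∞}`, `𝔸_{L,f}`, `𝔸_{L⁺,∞}`,
`𝔸_{L⁺,f}` are chosen inside the proof (Borel structures `borel _`); `μ_F` on `𝔸_{L⁺}` is a parameter because `hφarchZ` averages along the centre with it.
* §1 `flatSectionU_const_borel_mul`, `isUnitary_one` — the constant section is a Borel section of exponent `z` for the trivial unitary Hecke character.
* §2 `exists_bound_sub_borelConstantTerm_sphericalEisenstein_cm_three` — `∃ M₁, ∀ w ∈ Kc, ∀ g, T < H g → ‖E(φ₀H^w) g − E(φ₀H^w)_B g‖ ≤ M₁` for compact `Kc ⊂ {2 < Re} ∩ closedBall 0 R`.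
* §3 HEAD **`poleControl_sphericalEisenstein_cm_three_of_archSmooth`** — ★ p858209's (a1) ∧ (a2) ∧ (a3) with survivor `hφarchZ` only.
HONEST LABEL.  Count-neutral helper; proves no printed statement; HC_CM is proved only modulo the 7 printed citations (2 remaining named inputs: hLiu418 =
`stmt-HodgeConjecture-24832`, h413 = `stmt-HodgeConjecture-24833`) until rung 0 closes.  `hφarchZ` (payer (E-d) K2E1-p08 (g6)) is NOT discharged here; CEILING NOT CLAIMED (R7∕R8).

## References
* [MoeglinWaldspurger1995] C. Mœglin, J.-L. Waldspurger, *Spectral decomposition and Eisenstein series* (1995), II.1.7, IV.2.3, IV.3.12.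
* [Arthur1980TraceFormulaII] J. Arthur, *A trace formula for reductive groups II*, Compositio Math. 40 (1980), §4.
* [Garrett2018] P. Garrett, *Modern Analysis of Automorphic Forms by Example* 1 (2018), §1.12, §2.9, §11.3.
-/

set_option autoImplicit false
set_option linter.dupNamespace false  -- the mandated namespace repeats the summit's segment (`HodgeConjecture.HodgeConjecture`)

noncomputable section

open MeasureTheory Measure NumberField IsDedekindDomain Set Filter Topology MulAction Module
-- `Classical` is needed to see the Mathlib normed-space instances on `mixedSpace` (note H5 of `AdelicGLnGlue`)
open scoped ENNReal NNReal ComplexConjugate Classical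
open Literature.MeasureTheory.Group Literature.NumberTheory
open Literature.NumberTheory.Automorphic Literature.NumberTheory.Automorphic.UnitaryGroup Literature.NumberTheory.GaloisRepresentations AdelicGroupData
open NumberField.mixedEmbedding
open Summit.HodgeConjecture.HodgeConjecture.Cruxes.H413.K2E1BorelEisensteinU
open Summit.HodgeConjecture.HodgeConjecture.Cruxes.H413.K2E1MaassSelbergPoleControlSphericalCMThree
open Summit.HodgeConjecture.HodgeConjecture.Cruxes.H413.K2E1EisensteinMinusConstantTermBoundedCMThreeUniform
open Summit.HodgeConjecture.HodgeConjecture.Cruxes.H413.K2E1HeightLineArchSmoothUniformU3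
open Summit.HodgeConjecture.HodgeConjecture.Cruxes.H413.K2E1CentreLineMassU3
open Summit.HodgeConjecture.HodgeConjecture.Cruxes.H413.K2E1SiegelSetMultiplicityU3 (borelHeight_mul_of_mem_borelAdelic)
open Summit.HodgeConjecture.HodgeConjecture.Cruxes.H413.K2E1BorelParabolicIntegralU3 (borelHeight_coe_eq_ideleNorm_diagUnit)

namespace Summit.HodgeConjecture.HodgeConjecture.Cruxes.H413.K2E1MaassSelbergPoleControlSphericalCMThreeArch

variable (L : Type) [Field L] [NumberField L] [IsCMField L]
variable [MeasurableSpace (quasiSplit (↥(maximalRealSubfield L)) L (IsCMField.complexConj L) 3).Adelic] [BorelSpace (quasiSplit (↥(maximalRealSubfield L)) L (IsCMField.complexConj L) 3).Adelic]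
variable [MeasurableSpace (AdeleRing (𝓞 L) L)ˣ] [BorelSpace (AdeleRing (𝓞 L) L)ˣ]

/-! ## §1 The constant section is a Borel section for the trivial Hecke character -/

omit [IsCMField L] [MeasurableSpace (quasiSplit (↥(maximalRealSubfield L)) L (IsCMField.complexConj L) 3).Adelic] [BorelSpace (quasiSplit (↥(maximalRealSubfield L)) L (IsCMField.complexConj L) 3).Adelic]
  [MeasurableSpace (AdeleRing (𝓞 L) L)ˣ] [BorelSpace (AdeleRing (𝓞 L) L)ˣ] in
/-- **The trivial Hecke character is unitary.** [folklore] -/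
theorem isUnitary_one : (1 : HeckeCharacter L).IsUnitary := fun x => by
  rw [HeckeCharacter.one_apply, Units.val_one, norm_one]

omit [MeasurableSpace (quasiSplit (↥(maximalRealSubfield L)) L (IsCMField.complexConj L) 3).Adelic] [BorelSpace (quasiSplit (↥(maximalRealSubfield L)) L (IsCMField.complexConj L) 3).Adelic]
  [MeasurableSpace (AdeleRing (𝓞 L) L)ˣ] [BorelSpace (AdeleRing (𝓞 L) L)ˣ] in
/-- **THE CONSTANT SECTION `φ₀·H^z` IS A BOREL SECTION OF EXPONENT `z` FOR THE TRIVIAL CHARACTER**: `f(b g) = 1·‖d₀(b)‖^z·f(g)` for `b ∈ B(𝔸)` (`H(b g) = H(b)·H(g)` ★, `H(b) = ‖d₀(b)‖` ★) —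
the `hf` letter of ★ (R3u)₃ at `φ ≡ φ₀`, `χ = 1`. [cite: MoeglinWaldspurger1995, II.1.5] [cite: Garrett2018, §2.2] -/
theorem flatSectionU_const_borel_mul (φ₀ z : ℂ) (b g : (quasiSplit (↥(maximalRealSubfield L)) L (IsCMField.complexConj L) 3).Adelic) (hb : b ∈ borelAdelic ↥(maximalRealSubfield L) L (IsCMField.complexConj L) 3) :
    flatSectionU (fun _ : (quasiSplit (↥(maximalRealSubfield L)) L (IsCMField.complexConj L) 3).Adelic => φ₀) z (b * g) =
      (((1 : HeckeCharacter L) (diagUnit hb 0) : ℂˣ) : ℂ) * ((ideleNorm (diagUnit hb 0) : ℝ) : ℂ) ^ z * flatSectionU (fun _ : (quasiSplit (↥(maximalRealSubfield L)) L (IsCMField.complexConj L) 3).Adelic => φ₀) z g := by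
  have hH : borelHeight b = IdeleClassGroup.ideleNorm L (diagUnit hb 0) := borelHeight_coe_eq_ideleNorm_diagUnit (⟨b, hb⟩ : borelAdelic ↥(maximalRealSubfield L) L (IsCMField.complexConj L) 3)
  rw [flatSectionU_apply, flatSectionU_apply, HeckeCharacter.one_apply, Units.val_one, one_mul, borelHeight_mul_of_mem_borelAdelic hb g, hH, NNReal.coe_mul, Complex.ofReal_mul,
    Complex.mul_cpow_ofReal_nonneg (NNReal.coe_nonneg _) (NNReal.coe_nonneg _), coe_ideleNorm]
  ring

/-! ## §2 The cusp bound for the constant sections `φ₀·H^w`, uniformly on a compact `Kc ⊂ {2 < Re} ∩ closedBall 0 R` -/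

omit [MeasurableSpace (AdeleRing (𝓞 L) L)ˣ] [BorelSpace (AdeleRing (𝓞 L) L)ˣ] in
/-- **`∃ M₁, ∀ w ∈ Kc, ∀ g, T < H g → ‖E(φ₀H^w)(g) − E(φ₀H^w)_B(g)‖ ≤ M₁`** for compact `Kc ⊂ {2 < Re}` with `‖w‖ ≤ R` on `Kc` — ★ (R3u)₃ at `φ ≡ φ₀`, `χ = 1`, `U₀ = GL₃(𝒪̂_L)`, with the F-layer binder
★ (q11) and the named E-layer binder `hφarchZ` on `‖z′‖ ≤ R` (ONE `C_φ = max C_F C_E`; auxiliary Haar measures chosen inside). [cite: MoeglinWaldspurger1995, II.1.7, IV.2.3] [cite: Arthur1980TraceFormulaII, §4] -/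
theorem exists_bound_sub_borelConstantTerm_sphericalEisenstein_cm_three
    (hc : IsCMField.complexConj L * IsCMField.complexConj L = 1) {δ : L} (hcδ : IsCMField.complexConj L δ = -δ) (hδ : δ ≠ 0)
    (ν : Measure ↥(adelicUnipotent (↥(maximalRealSubfield L)) L (IsCMField.complexConj L) 3)) [ν.IsHaarMeasure]
    {𝓕 : Set ↥(adelicUnipotent (↥(maximalRealSubfield L)) L (IsCMField.complexConj L) 3)} (h𝓕N : IsFundamentalDomain ↥(rationalUnipotent (↥(maximalRealSubfield L)) L (IsCMField.complexConj L) 3) 𝓕 ν) (h𝓕c : IsCompact (closure 𝓕))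
    [MeasurableSpace (AdeleRing (𝓞 ↥(maximalRealSubfield L)) ↥(maximalRealSubfield L))] [BorelSpace (AdeleRing (𝓞 ↥(maximalRealSubfield L)) ↥(maximalRealSubfield L))]
    (μF : Measure (AdeleRing (𝓞 ↥(maximalRealSubfield L)) ↥(maximalRealSubfield L))) [μF.IsAddHaarMeasure] {m : ℕ} (hm : (finrank ℚ L : ℝ) < m)
    {T : ℝ≥0} (hT : 1 ≤ T) (φ₀ : ℂ)
    (hφarchZ : ∀ R : ℝ, ∃ Cφ : ℝ, 0 ≤ Cφ ∧ ∀ z' : ℂ, ‖z'‖ ≤ R → ∀ k ∈ ((standardMaximalCompactGL 3 L).comap (adelicVal ↥(maximalRealSubfield L) L (IsCMField.complexConj L) 3 ((StdForm.antidiagonal 3).over L)) : Subgroup (quasiSplit (↥(maximalRealSubfield L)) L (IsCMField.complexConj L) 3).Adelic), ∀ B : FiniteAdeleRing (𝓞 L) L,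
      ContDiff ℝ m ((fun a : InfiniteAdeleRing L => ((μF (adeleFundamentalDomain ↥(maximalRealSubfield L))).toReal⁻¹ : ℂ) *
          ∫ t, flatSectionU (fun _ : (quasiSplit (↥(maximalRealSubfield L)) L (IsCMField.complexConj L) 3).Adelic => φ₀) z' (((quasiSplit (↥(maximalRealSubfield L)) L (IsCMField.complexConj L) 3).toAdelic (weylLongU ((IsCMField.complexConj L : L ≃ₐ[↥(maximalRealSubfield L)] L) : L →+* L) (rfl : ((StdForm.antidiagonal 3).over L) = ((StdForm.antidiagonal 3).over L)))) *
            ((heisChart hc (((a, B) : AdeleRing (𝓞 L) L), traceZeroLine ↥(maximalRealSubfield L) L (IsCMField.complexConj L) hcδ hδ t) : ↥(adelicUnipotent ↥(maximalRealSubfield L) L (IsCMField.complexConj L) 3)) : (quasiSplit (↥(maximalRealSubfield L)) L (IsCMField.complexConj L) 3).Adelic) * k) ∂μF) ∘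
        (InfiniteAdeleRing.ringEquiv_mixedSpace L).symm) ∧
      ∀ j : ℕ, j ≤ m → ∀ s : mixedSpace L,
        ‖iteratedFDeriv ℝ j ((fun a : InfiniteAdeleRing L => ((μF (adeleFundamentalDomain ↥(maximalRealSubfield L))).toReal⁻¹ : ℂ) *
          ∫ t, flatSectionU (fun _ : (quasiSplit (↥(maximalRealSubfield L)) L (IsCMField.complexConj L) 3).Adelic => φ₀) z' (((quasiSplit (↥(maximalRealSubfield L)) L (IsCMField.complexConj L) 3).toAdelic (weylLongU ((IsCMField.complexConj L : L ≃ₐ[↥(maximalRealSubfield L)] L) : L →+* L) (rfl : ((StdForm.antidiagonal 3).over L) = ((StdForm.antidiagonal 3).over L)))) *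
            ((heisChart hc (((a, B) : AdeleRing (𝓞 L) L), traceZeroLine ↥(maximalRealSubfield L) L (IsCMField.complexConj L) hcδ hδ t) : ↥(adelicUnipotent ↥(maximalRealSubfield L) L (IsCMField.complexConj L) 3)) : (quasiSplit (↥(maximalRealSubfield L)) L (IsCMField.complexConj L) 3).Adelic) * k) ∂μF) ∘
          (InfiniteAdeleRing.ringEquiv_mixedSpace L).symm) s‖ ≤
          ∫ t, Cφ * ((borelHeight (((quasiSplit (↥(maximalRealSubfield L)) L (IsCMField.complexConj L) 3).toAdelic (weylLongU ((IsCMField.complexConj L : L ≃ₐ[↥(maximalRealSubfield L)] L) : L →+* L) (rfl : ((StdForm.antidiagonal 3).over L) = ((StdForm.antidiagonal 3).over L)))) *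
            ((heisChart hc (((((InfiniteAdeleRing.ringEquiv_mixedSpace L).symm s), B) : AdeleRing (𝓞 L) L), traceZeroLine ↥(maximalRealSubfield L) L (IsCMField.complexConj L) hcδ hδ t) : ↥(adelicUnipotent ↥(maximalRealSubfield L) L (IsCMField.complexConj L) 3)) :
              (quasiSplit (↥(maximalRealSubfield L)) L (IsCMField.complexConj L) 3).Adelic) * k) : ℝ)) ^ z'.re ∂μF)
    {Kc : Set ℂ} (hKc : IsCompact Kc) (hKc2 : ∀ w ∈ Kc, 2 < w.re) {R : ℝ} (hR : ∀ w ∈ Kc, ‖w‖ ≤ R) :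
    ∃ M₁ : ℝ, ∀ w ∈ Kc, ∀ g : (quasiSplit (↥(maximalRealSubfield L)) L (IsCMField.complexConj L) 3).Adelic, T < borelHeight g →
      ‖eisensteinSeriesU (flatSectionU (fun _ : (quasiSplit (↥(maximalRealSubfield L)) L (IsCMField.complexConj L) 3).Adelic => φ₀) w) g - borelConstantTerm ν 𝓕 (eisensteinSeriesU (flatSectionU (fun _ : (quasiSplit (↥(maximalRealSubfield L)) L (IsCMField.complexConj L) 3).Adelic => φ₀) w)) g‖ ≤ M₁ := by
  -- auxiliary Borel structures and additive Haar measures (not in the statement)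
  letI : MeasurableSpace (AdeleRing (𝓞 L) L) := borel _
  haveI : BorelSpace (AdeleRing (𝓞 L) L) := ⟨rfl⟩
  letI : MeasurableSpace (InfiniteAdeleRing L) := borel _
  haveI : BorelSpace (InfiniteAdeleRing L) := ⟨rfl⟩
  letI : MeasurableSpace (FiniteAdeleRing (𝓞 L) L) := borel _
  haveI : BorelSpace (FiniteAdeleRing (𝓞 L) L) := ⟨rfl⟩
  letI : MeasurableSpace (InfiniteAdeleRing ↥(maximalRealSubfield L)) := borel _
  haveI : BorelSpace (InfiniteAdeleRing ↥(maximalRealSubfield L)) := ⟨rfl⟩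
  letI : MeasurableSpace (FiniteAdeleRing (𝓞 ↥(maximalRealSubfield L)) ↥(maximalRealSubfield L)) := borel _
  haveI : BorelSpace (FiniteAdeleRing (𝓞 ↥(maximalRealSubfield L)) ↥(maximalRealSubfield L)) := ⟨rfl⟩
  haveI := locallyCompactSpace_adeleRing' L
  haveI := locallyCompactSpace_finiteAdeleRing' L
  haveI := locallyCompactSpace_finiteAdeleRing' ↥(maximalRealSubfield L)
  haveI : Algebra.IsQuadraticExtension ↥(maximalRealSubfield L) L := IsCMField.isQuadraticExtension L
  have hc1 : IsCMField.complexConj L ≠ 1 := IsCMField.complexConj_ne_one L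
  have hIw := exists_mem_borelAdelic_mul_mem_standardMaximalCompactGL_cm_three L
  -- the two archimedean constants on `‖z′‖ ≤ R`, merged into ONE `C_φ`
  obtain ⟨CF, hCF, hF⟩ := exists_archSmooth_flatSectionU_const_cm_three_uniform L hc hcδ hδ φ₀ m R
  obtain ⟨CE, -, hE⟩ := hφarchZ R
  refine exists_bound_sub_borelConstantTerm_level_cm_three_uniform_of_archSmooth L hc hcδ hδ ν h𝓕N h𝓕c μF
    (Measure.addHaar : Measure (InfiniteAdeleRing ↥(maximalRealSubfield L))) (Measure.addHaar : Measure (FiniteAdeleRing (𝓞 ↥(maximalRealSubfield L)) ↥(maximalRealSubfield L)))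
    (Measure.addHaar : Measure (AdeleRing (𝓞 L) L)) (Measure.addHaar : Measure (InfiniteAdeleRing L)) (Measure.addHaar : Measure (FiniteAdeleRing (𝓞 L) L))
    (1 : HeckeCharacter L) (isUnitary_one L) hKc hKc2 continuous_const (Mφ := ‖φ₀‖) (fun _ => le_rfl) (fun _ _ _ => rfl)
    (fun w _ b g hb => flatSectionU_const_borel_mul L φ₀ w b g hb) (isOpen_glFiniteIntegralLevel 3 L) le_rfl (fun _ _ _ => rfl) hT hm (le_max_of_le_left hCF : (0 : ℝ) ≤ max CF CE)
    (fun w hw k hk X b => ⟨(hF w (hR w hw) k hk X b).1, fun j hj s => ((hF w (hR w hw) k hk X b).2 j hj s).trans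
      (mul_le_mul_of_nonneg_right (le_max_left _ _) (Real.rpow_nonneg (NNReal.coe_nonneg _) _))⟩) (fun w hw k hk B => ⟨(hE w (hR w hw) k hk B).1, fun j hj s => ?_⟩)
  refine ((hE w (hR w hw) k hk B).2 j hj s).trans (integral_mono ?_ ?_ fun t => ?_)
  · exact (integrable_centreLine_borelHeight_rpow_three hc hc1 hcδ hδ hIw μF (hKc2 w hw) _ k).const_mul CE
  · exact (integrable_centreLine_borelHeight_rpow_three hc hc1 hcδ hδ hIw μF (hKc2 w hw) _ k).const_mul (max CF CE)
  · exact mul_le_mul_of_nonneg_right (le_max_right _ _) (Real.rpow_nonneg (NNReal.coe_nonneg _) _)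

/-! ## §3 The head: edition 2 of ★ p858209 -/

/-- **POLE CONTROL AT THE SPHERICAL VECTOR OF `U(2,1)` OVER A CM FIELD ON THE GODEMENT HALF-PLANE, EDITION 2** — ★ p858209 `poleControl_sphericalEisenstein_cm_three` with its decay
survivors `hdec′` (pointwise on the sub-tube) and `hdecU` (locally uniform at `z`, on `closedBall z ((Re z − 2)∕2)`) DISCHARGED by §2; survivor: the E-layer archimedean symbol binder
`hφarchZ` (∀ R, ∃ C_φ, ∀ ‖z′‖ ≤ R; payer (E-d) K2E1-p08 (g6)).  Conclusion verbatim ★ p858209's (a1) ∧ (a2) ∧ (a3) with `a, b` EXPLICIT.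
[cite: MoeglinWaldspurger1995, IV.2.3 and IV.3.12 (a)] [cite: Arthur1980TraceFormulaII, §4] [cite: Garrett2018, §1.12 and §11.3] -/
theorem poleControl_sphericalEisenstein_cm_three_of_archSmooth
    (μ : Measure (quasiSplit (↥(maximalRealSubfield L)) L (IsCMField.complexConj L) 3).automorphicQuotient) [(quasiSplit (↥(maximalRealSubfield L)) L (IsCMField.complexConj L) 3).IsAutomorphicMeasure μ]
    (νG : Measure (quasiSplit (↥(maximalRealSubfield L)) L (IsCMField.complexConj L) 3).Adelic) [νG.IsHaarMeasure] [νG.IsInvInvariant]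
    (μK : Measure ((standardMaximalCompactGL 3 L).comap (adelicVal (↥(maximalRealSubfield L)) L (IsCMField.complexConj L) 3 ((StdForm.antidiagonal 3).over L)) : Subgroup (quasiSplit (↥(maximalRealSubfield L)) L (IsCMField.complexConj L) 3).Adelic))
    [μK.IsHaarMeasure]
    (νI : Measure (AdeleRing (𝓞 L) L)ˣ) [νI.IsHaarMeasure]
    {𝓕I : Set (AdeleRing (𝓞 L) L)ˣ} (h𝓕I : IsIdeleClassDomain L 𝓕I)
    (ν : Measure ↥(adelicUnipotent (↥(maximalRealSubfield L)) L (IsCMField.complexConj L) 3)) [ν.IsHaarMeasure] [ν.IsInvInvariant]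
    {𝓕 : Set ↥(adelicUnipotent (↥(maximalRealSubfield L)) L (IsCMField.complexConj L) 3)} (h𝓕N : IsFundamentalDomain ↥(rationalUnipotent (↥(maximalRealSubfield L)) L (IsCMField.complexConj L) 3) 𝓕 ν) (h𝓕1 : ν 𝓕 = 1) (h𝓕c : IsCompact (closure 𝓕))
    {β : (quasiSplit (↥(maximalRealSubfield L)) L (IsCMField.complexConj L) 3).Adelic → ℝ≥0∞} (hβ : IsCoveringWeight ((arithmeticBorel (↥(maximalRealSubfield L)) L (IsCMField.complexConj L) 3).map (quasiSplit (↥(maximalRealSubfield L)) L (IsCMField.complexConj L) 3).arithmeticSubgroup.subtype) β)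
    {T : ℝ≥0} (hT : 1 ≤ T) {φ₀ : ℂ} (hφ₀ : φ₀ ≠ 0) {z : ℂ} (hz : 2 < z.re) (hy : z.im ≠ 0)
    -- the CM letters of the Heisenberg chart, an additive Haar measure on `𝔸_{L⁺}` (for the centre averages), and the archimedean order `m > [L:ℚ]`
    (hc : IsCMField.complexConj L * IsCMField.complexConj L = 1) {δ : L} (hcδ : IsCMField.complexConj L δ = -δ) (hδ : δ ≠ 0)
    [MeasurableSpace (AdeleRing (𝓞 ↥(maximalRealSubfield L)) ↥(maximalRealSubfield L))] [BorelSpace (AdeleRing (𝓞 ↥(maximalRealSubfield L)) ↥(maximalRealSubfield L))]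
    (μF : Measure (AdeleRing (𝓞 ↥(maximalRealSubfield L)) ↥(maximalRealSubfield L))) [μF.IsAddHaarMeasure] {m : ℕ} (hm : (finrank ℚ L : ℝ) < m)
    -- THE ONLY NAMED INPUT: the E-layer archimedean binder of ★ PART II at the spherical vector, locally uniform in `z′` (payer (E-d) K2E1-p08 (g6)); the F-layer one is ★ (q11) p858234
    (hφarchZ : ∀ R : ℝ, ∃ Cφ : ℝ, 0 ≤ Cφ ∧ ∀ z' : ℂ, ‖z'‖ ≤ R → ∀ k ∈ ((standardMaximalCompactGL 3 L).comap (adelicVal ↥(maximalRealSubfield L) L (IsCMField.complexConj L) 3 ((StdForm.antidiagonal 3).over L)) : Subgroup (quasiSplit (↥(maximalRealSubfield L)) L (IsCMField.complexConj L) 3).Adelic), ∀ B : FiniteAdeleRing (𝓞 L) L,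
      ContDiff ℝ m ((fun a : InfiniteAdeleRing L => ((μF (adeleFundamentalDomain ↥(maximalRealSubfield L))).toReal⁻¹ : ℂ) *
          ∫ t, flatSectionU (fun _ : (quasiSplit (↥(maximalRealSubfield L)) L (IsCMField.complexConj L) 3).Adelic => φ₀) z' (((quasiSplit (↥(maximalRealSubfield L)) L (IsCMField.complexConj L) 3).toAdelic (weylLongU ((IsCMField.complexConj L : L ≃ₐ[↥(maximalRealSubfield L)] L) : L →+* L) (rfl : ((StdForm.antidiagonal 3).over L) = ((StdForm.antidiagonal 3).over L)))) *
            ((heisChart hc (((a, B) : AdeleRing (𝓞 L) L), traceZeroLine ↥(maximalRealSubfield L) L (IsCMField.complexConj L) hcδ hδ t) : ↥(adelicUnipotent ↥(maximalRealSubfield L) L (IsCMField.complexConj L) 3)) : (quasiSplit (↥(maximalRealSubfield L)) L (IsCMField.complexConj L) 3).Adelic) * k) ∂μF) ∘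
        (InfiniteAdeleRing.ringEquiv_mixedSpace L).symm) ∧
      ∀ j : ℕ, j ≤ m → ∀ s : mixedSpace L,
        ‖iteratedFDeriv ℝ j ((fun a : InfiniteAdeleRing L => ((μF (adeleFundamentalDomain ↥(maximalRealSubfield L))).toReal⁻¹ : ℂ) *
          ∫ t, flatSectionU (fun _ : (quasiSplit (↥(maximalRealSubfield L)) L (IsCMField.complexConj L) 3).Adelic => φ₀) z' (((quasiSplit (↥(maximalRealSubfield L)) L (IsCMField.complexConj L) 3).toAdelic (weylLongU ((IsCMField.complexConj L : L ≃ₐ[↥(maximalRealSubfield L)] L) : L →+* L) (rfl : ((StdForm.antidiagonal 3).over L) = ((StdForm.antidiagonal 3).over L)))) *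
            ((heisChart hc (((a, B) : AdeleRing (𝓞 L) L), traceZeroLine ↥(maximalRealSubfield L) L (IsCMField.complexConj L) hcδ hδ t) : ↥(adelicUnipotent ↥(maximalRealSubfield L) L (IsCMField.complexConj L) 3)) : (quasiSplit (↥(maximalRealSubfield L)) L (IsCMField.complexConj L) 3).Adelic) * k) ∂μF) ∘
          (InfiniteAdeleRing.ringEquiv_mixedSpace L).symm) s‖ ≤
          ∫ t, Cφ * ((borelHeight (((quasiSplit (↥(maximalRealSubfield L)) L (IsCMField.complexConj L) 3).toAdelic (weylLongU ((IsCMField.complexConj L : L ≃ₐ[↥(maximalRealSubfield L)] L) : L →+* L) (rfl : ((StdForm.antidiagonal 3).over L) = ((StdForm.antidiagonal 3).over L)))) *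
            ((heisChart hc (((((InfiniteAdeleRing.ringEquiv_mixedSpace L).symm s), B) : AdeleRing (𝓞 L) L), traceZeroLine ↥(maximalRealSubfield L) L (IsCMField.complexConj L) hcδ hδ t) : ↥(adelicUnipotent ↥(maximalRealSubfield L) L (IsCMField.complexConj L) 3)) :
              (quasiSplit (↥(maximalRealSubfield L)) L (IsCMField.complexConj L) 3).Adelic) * k) : ℝ)) ^ z'.re ∂μF) :
    Real.sqrt ((∫ x in {x : (AdeleRing (𝓞 L) L)ˣ | (IdeleClassGroup.ideleNorm L x : ℝ) ≤ 1} ∩ 𝓕I, (IdeleClassGroup.ideleNorm L x : ℝ) ∂νI) * μK.real Set.univ * ‖(∫ v : ↥(adelicUnipotent (↥(maximalRealSubfield L)) L (IsCMField.complexConj L) 3), (((borelHeight ((quasiSplit (↥(maximalRealSubfield L)) L (IsCMField.complexConj L) 3).toAdelic (weylLongU ((IsCMField.complexConj L : L ≃ₐ[↥(maximalRealSubfield L)] L) : L →+* L) (rfl : (StdForm.antidiagonal 3).over L = (StdForm.antidiagonal 3).over L)) * (v : (quasiSplit (↥(maximalRealSubfield L)) L (IsCMField.complexConj L) 3).Adelic)))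 : ℝ) : ℂ) ^ z ∂ν)‖ ^ 2 * ‖φ₀‖ ^ 2) ≤
        (z.re - 1) * (T : ℝ) ^ (2 * (z.re - 1)) * Real.sqrt ((∫ x in {x : (AdeleRing (𝓞 L) L)ˣ | (IdeleClassGroup.ideleNorm L x : ℝ) ≤ 1} ∩ 𝓕I, (IdeleClassGroup.ideleNorm L x : ℝ) ∂νI) * μK.real Set.univ * ‖φ₀‖ ^ 2) / |z.im| +
          Real.sqrt ((z.re - 1) ^ 2 * (T : ℝ) ^ (4 * (z.re - 1)) * ((∫ x in {x : (AdeleRing (𝓞 L) L)ˣ | (IdeleClassGroup.ideleNorm L x : ℝ) ≤ 1} ∩ 𝓕I, (IdeleClassGroup.ideleNorm L x : ℝ) ∂νI) * μK.real Set.univ * ‖φ₀‖ ^ 2) / z.im ^ 2 + ((∫ x in {x : (AdeleRing (𝓞 L) L)ˣ | (IdeleClassGroup.ideleNorm L x : ℝ) ≤ 1} ∩ 𝓕I, (IdeleClassGroup.ideleNorm L x : ℝ) ∂νI) * μK.real Set.univ * ‖φ₀‖ ^ 2) * (T : ℝ) ^ (4 * (z.re - 1))) ∧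
      (∀ {x₁ x₂ η : ℝ}, 0 < x₁ → z.re - 1 ∈ Set.Icc x₁ x₂ → 0 < η → η ≤ |z.im| →
        ((∫ x in {x : (AdeleRing (𝓞 L) L)ˣ | (IdeleClassGroup.ideleNorm L x : ℝ) ≤ 1} ∩ 𝓕I, (IdeleClassGroup.ideleNorm L x : ℝ) ∂νI) * μK.real Set.univ * ‖(∫ v : ↥(adelicUnipotent (↥(maximalRealSubfield L)) L (IsCMField.complexConj L) 3), (((borelHeight ((quasiSplit (↥(maximalRealSubfield L)) L (IsCMField.complexConj L) 3).toAdelic (weylLongU ((IsCMField.complexConj L : L ≃ₐ[↥(maximalRealSubfield L)] L) : L →+* L) (rfl : (StdForm.antidiagonal 3).over L = (StdForm.antidiagonal 3).over L)) * (v : (quasiSplit (↥(maximalRealSubfield L)) L (IsCMField.complexConj L) 3).Adelic))) : ℝ) : ℂ) ^ z ∂ν)‖ ^ 2 * ‖φ₀‖ ^ 2) ≤ (x₂ * (T : ℝ) ^ (2 * x₂) * Real.sqrt ((∫ x in {x : (AdeleRing (𝓞 L) L)ˣ | (IdeleClassGroup.ideleNorm L x : ℝ) ≤ 1} ∩ 𝓕I,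 (IdeleClassGroup.ideleNorm L x : ℝ) ∂νI) * μK.real Set.univ * ‖φ₀‖ ^ 2) / η + Real.sqrt (x₂ ^ 2 * (T : ℝ) ^ (4 * x₂) * ((∫ x in {x : (AdeleRing (𝓞 L) L)ˣ | (IdeleClassGroup.ideleNorm L x : ℝ) ≤ 1} ∩ 𝓕I, (IdeleClassGroup.ideleNorm L x : ℝ) ∂νI) * μK.real Set.univ * ‖φ₀‖ ^ 2) / η ^ 2 + ((∫ x in {x : (AdeleRing (𝓞 L) L)ˣ | (IdeleClassGroup.ideleNorm L x : ℝ) ≤ 1} ∩ 𝓕I, (IdeleClassGroup.ideleNorm L x : ℝ) ∂νI) * μK.real Set.univ * ‖φ₀‖ ^ 2) * (T : ℝ) ^ (4 * x₂))) ^ 2) ∧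
      (|z.im| ≤ 1 → ((∫ x in {x : (AdeleRing (𝓞 L) L)ˣ | (IdeleClassGroup.ideleNorm L x : ℝ) ≤ 1} ∩ 𝓕I, (IdeleClassGroup.ideleNorm L x : ℝ) ∂νI) * μK.real Set.univ * ‖(∫ v : ↥(adelicUnipotent (↥(maximalRealSubfield L)) L (IsCMField.complexConj L) 3), (((borelHeight ((quasiSplit (↥(maximalRealSubfield L)) L (IsCMField.complexConj L) 3).toAdelic (weylLongU ((IsCMField.complexConj L : L ≃ₐ[↥(maximalRealSubfield L)] L) : L →+* L) (rfl : (StdForm.antidiagonal 3).over L = (StdForm.antidiagonal 3).over L)) * (v : (quasiSplit (↥(maximalRealSubfield L)) L (IsCMField.complexConj L) 3).Adelic))) : ℝ) : ℂ) ^ z ∂ν)‖ ^ 2 * ‖φ₀‖ ^ 2) ≤ ((z.re - 1) * (T : ℝ) ^ (2 * (z.re - 1)) * Real.sqrt ((∫ x in {x : (AdeleRing (𝓞 L) L)ˣ | (IdeleClassGroup.ideleNorm L x : ℝ) ≤ 1} ∩ 𝓕I, (IdeleClassGroup.ideleNorm L x : ℝ) ∂νI) * μK.real Set.univ * ‖φ₀‖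 ^ 2) +
        Real.sqrt ((z.re - 1) ^ 2 * (T : ℝ) ^ (4 * (z.re - 1)) * ((∫ x in {x : (AdeleRing (𝓞 L) L)ˣ | (IdeleClassGroup.ideleNorm L x : ℝ) ≤ 1} ∩ 𝓕I, (IdeleClassGroup.ideleNorm L x : ℝ) ∂νI) * μK.real Set.univ * ‖φ₀‖ ^ 2) + ((∫ x in {x : (AdeleRing (𝓞 L) L)ˣ | (IdeleClassGroup.ideleNorm L x : ℝ) ≤ 1} ∩ 𝓕I, (IdeleClassGroup.ideleNorm L x : ℝ) ∂νI) * μK.real Set.univ * ‖φ₀‖ ^ 2) * (T : ℝ) ^ (4 * (z.re - 1)))) ^ 2 / z.im ^ 2) := by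
  -- `hdec′`: pointwise on the sub-tube — the singleton compact
  have hdec' : ∀ z' : ℂ, 2 < z'.re → z'.re < z.re → ∃ M₁' : ℝ, ∀ g : (quasiSplit (↥(maximalRealSubfield L)) L (IsCMField.complexConj L) 3).Adelic, T < borelHeight g →
      ‖eisensteinSeriesU (flatSectionU (fun _ : (quasiSplit (↥(maximalRealSubfield L)) L (IsCMField.complexConj L) 3).Adelic => φ₀) z') g - borelConstantTerm ν 𝓕 (eisensteinSeriesU (flatSectionU (fun _ : (quasiSplit (↥(maximalRealSubfield L)) L (IsCMField.complexConj L) 3).Adelic => φ₀) z')) g‖ ≤ M₁' := by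
    intro z' hz' _
    obtain ⟨M₁', h⟩ := exists_bound_sub_borelConstantTerm_sphericalEisenstein_cm_three L hc hcδ hδ ν h𝓕N h𝓕c μF hm hT φ₀ hφarchZ isCompact_singleton
      (fun w hw => by rw [Set.mem_singleton_iff.1 hw]; exact hz') (R := ‖z'‖) (fun w hw => by rw [Set.mem_singleton_iff.1 hw])
    exact ⟨M₁', h z' (Set.mem_singleton z')⟩
  -- `hdecU`: locally uniform at `z` — the closed ball of radius `r = (Re z − 2)∕2` sits in `{2 < Re}` and in `closedBall 0 (‖z‖ + r)`
  have hr : 0 < (z.re - 2) / 2 := by linarith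
  have hball2 : ∀ w ∈ Metric.closedBall z ((z.re - 2) / 2), 2 < w.re := fun w hw => by
    have h1 : |w.re - z.re| ≤ ‖w - z‖ := by simpa only [Complex.sub_re] using Complex.abs_re_le_norm (w - z)
    have h2 : ‖w - z‖ ≤ (z.re - 2) / 2 := mem_closedBall_iff_norm.1 hw
    have h3 := (abs_le.1 (h1.trans h2)).1
    linarith
  have hballR : ∀ w ∈ Metric.closedBall z ((z.re - 2) / 2), ‖w‖ ≤ ‖z‖ + (z.re - 2) / 2 := fun w hw =>
    (norm_le_norm_add_norm_sub' w z).trans (by linarith [mem_closedBall_iff_norm.1 hw])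
  obtain ⟨M₁, hdecU⟩ := exists_bound_sub_borelConstantTerm_sphericalEisenstein_cm_three L hc hcδ hδ ν h𝓕N h𝓕c μF hm hT φ₀ hφarchZ (isCompact_closedBall z ((z.re - 2) / 2))
    hball2 hballR
  exact poleControl_sphericalEisenstein_cm_three L μ νG μK νI h𝓕I ν h𝓕N h𝓕1 h𝓕c hβ hT hφ₀ hz hy hdec' (Metric.closedBall_mem_nhds z hr) hdecU

/-! ## §4 EDITION 3 — `hφarchZ` DISCHARGED by ★ (E-d) `K2E1HeightLineArchSmoothU3E`: pole control at the spherical vector of `U(2,1)` over a CM field, NOTHING NAMED -/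

/-- **POLE CONTROL AT THE SPHERICAL VECTOR OF `U(2,1)` OVER A CM FIELD ON THE GODEMENT HALF-PLANE, EDITION 3 — THE LETTERS EDITION.**  §3
`poleControl_sphericalEisenstein_cm_three_of_archSmooth` with its only named input `hφarchZ` DISCHARGED by ★ (E-d) `exists_archSmoothZ_flatSectionU_const_cm_three_uniform` (one
`fun R => …` plug): for `Re z > 2`, `Im z ≠ 0`, `T ≥ 1`, `φ₀ ≠ 0` and ANY letters of the discharge (`c² = 1`, a trace-zero `δ ∈ L⁻ ∖ 0`, an additive Haar measure `μ_F` on `𝔸_{L⁺}`, an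
archimedean order `m > [L:ℚ]`) — (a1) ∧ (a2) ∧ (a3) verbatim ★ p858209 with `a, b` EXPLICIT.  No named hypothesis remains.
[cite: MoeglinWaldspurger1995, IV.2.3 and IV.3.12 (a)] [cite: Arthur1980TraceFormulaII, §4] [cite: Garrett2018, §1.12 and §11.3] -/
theorem poleControl_sphericalEisenstein_cm_three_of_letters
    (μ : Measure (quasiSplit (↥(maximalRealSubfield L)) L (IsCMField.complexConj L) 3).automorphicQuotient) [(quasiSplit (↥(maximalRealSubfield L)) L (IsCMField.complexConj L) 3).IsAutomorphicMeasure μ]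
    (νG : Measure (quasiSplit (↥(maximalRealSubfield L)) L (IsCMField.complexConj L) 3).Adelic) [νG.IsHaarMeasure] [νG.IsInvInvariant]
    (μK : Measure ((standardMaximalCompactGL 3 L).comap (adelicVal (↥(maximalRealSubfield L)) L (IsCMField.complexConj L) 3 ((StdForm.antidiagonal 3).over L)) : Subgroup (quasiSplit (↥(maximalRealSubfield L)) L (IsCMField.complexConj L) 3).Adelic))
    [μK.IsHaarMeasure]
    (νI : Measure (AdeleRing (𝓞 L) L)ˣ) [νI.IsHaarMeasure]
    {𝓕I : Set (AdeleRing (𝓞 L) L)ˣ} (h𝓕I : IsIdeleClassDomain L 𝓕I)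
    (ν : Measure ↥(adelicUnipotent (↥(maximalRealSubfield L)) L (IsCMField.complexConj L) 3)) [ν.IsHaarMeasure] [ν.IsInvInvariant]
    {𝓕 : Set ↥(adelicUnipotent (↥(maximalRealSubfield L)) L (IsCMField.complexConj L) 3)} (h𝓕N : IsFundamentalDomain ↥(rationalUnipotent (↥(maximalRealSubfield L)) L (IsCMField.complexConj L) 3) 𝓕 ν) (h𝓕1 : ν 𝓕 = 1) (h𝓕c : IsCompact (closure 𝓕))
    {β : (quasiSplit (↥(maximalRealSubfield L)) L (IsCMField.complexConj L) 3).Adelic → ℝ≥0∞} (hβ : IsCoveringWeight ((arithmeticBorel (↥(maximalRealSubfield L)) L (IsCMField.complexConj L) 3).map (quasiSplit (↥(maximalRealSubfield L)) L (IsCMField.complexConj L) 3).arithmeticSubgroup.subtype) β)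
    {T : ℝ≥0} (hT : 1 ≤ T) {φ₀ : ℂ} (hφ₀ : φ₀ ≠ 0) {z : ℂ} (hz : 2 < z.re) (hy : z.im ≠ 0)
    -- the CM letters of the Heisenberg chart, an additive Haar measure on `𝔸_{L⁺}` (for the centre averages), and the archimedean order `m > [L:ℚ]`
    (hc : IsCMField.complexConj L * IsCMField.complexConj L = 1) {δ : L} (hcδ : IsCMField.complexConj L δ = -δ) (hδ : δ ≠ 0)
    [MeasurableSpace (AdeleRing (𝓞 ↥(maximalRealSubfield L)) ↥(maximalRealSubfield L))] [BorelSpace (AdeleRing (𝓞 ↥(maximalRealSubfield L)) ↥(maximalRealSubfield L))]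
    (μF : Measure (AdeleRing (𝓞 ↥(maximalRealSubfield L)) ↥(maximalRealSubfield L))) [μF.IsAddHaarMeasure] {m : ℕ} (hm : (finrank ℚ L : ℝ) < m) :
    Real.sqrt ((∫ x in {x : (AdeleRing (𝓞 L) L)ˣ | (IdeleClassGroup.ideleNorm L x : ℝ) ≤ 1} ∩ 𝓕I, (IdeleClassGroup.ideleNorm L x : ℝ) ∂νI) * μK.real Set.univ * ‖(∫ v : ↥(adelicUnipotent (↥(maximalRealSubfield L)) L (IsCMField.complexConj L) 3), (((borelHeight ((quasiSplit (↥(maximalRealSubfield L)) L (IsCMField.complexConj L) 3).toAdelic (weylLongU ((IsCMField.complexConj L : L ≃ₐ[↥(maximalRealSubfield L)] L) : L →+* L) (rfl : (StdForm.antidiagonal 3).over L = (StdForm.antidiagonal 3).over L)) * (v : (quasiSplit (↥(maximalRealSubfield L)) L (IsCMField.complexConj L) 3).Adelic))) : ℝ) : ℂ) ^ z ∂ν)‖ ^ 2 * ‖φ₀‖ ^ 2) ≤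
        (z.re - 1) * (T : ℝ) ^ (2 * (z.re - 1)) * Real.sqrt ((∫ x in {x : (AdeleRing (𝓞 L) L)ˣ | (IdeleClassGroup.ideleNorm L x : ℝ) ≤ 1} ∩ 𝓕I, (IdeleClassGroup.ideleNorm L x : ℝ) ∂νI) * μK.real Set.univ * ‖φ₀‖ ^ 2) / |z.im| +
          Real.sqrt ((z.re - 1) ^ 2 * (T : ℝ) ^ (4 * (z.re - 1)) * ((∫ x in {x : (AdeleRing (𝓞 L) L)ˣ | (IdeleClassGroup.ideleNorm L x : ℝ) ≤ 1} ∩ 𝓕I, (IdeleClassGroup.ideleNorm L x : ℝ) ∂νI) * μK.real Set.univ * ‖φ₀‖ ^ 2) / z.im ^ 2 + ((∫ x in {x : (AdeleRing (𝓞 L) L)ˣ | (IdeleClassGroup.ideleNorm L x : ℝ) ≤ 1} ∩ 𝓕I, (IdeleClassGroup.ideleNorm L x : ℝ) ∂νI) * μK.real Set.univ * ‖φ₀‖ ^ 2) * (T : ℝ) ^ (4 * (z.re - 1))) ∧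
      (∀ {x₁ x₂ η : ℝ}, 0 < x₁ → z.re - 1 ∈ Set.Icc x₁ x₂ → 0 < η → η ≤ |z.im| →
        ((∫ x in {x : (AdeleRing (𝓞 L) L)ˣ | (IdeleClassGroup.ideleNorm L x : ℝ) ≤ 1} ∩ 𝓕I, (IdeleClassGroup.ideleNorm L x : ℝ) ∂νI) * μK.real Set.univ * ‖(∫ v : ↥(adelicUnipotent (↥(maximalRealSubfield L)) L (IsCMField.complexConj L) 3), (((borelHeight ((quasiSplit (↥(maximalRealSubfield L)) L (IsCMField.complexConj L) 3).toAdelic (weylLongU ((IsCMField.complexConj L : L ≃ₐ[↥(maximalRealSubfield L)] L) : L →+* L) (rfl : (StdForm.antidiagonal 3).over L = (StdForm.antidiagonal 3).over L)) * (v : (quasiSplit (↥(maximalRealSubfield L)) L (IsCMField.complexConj L) 3).Adelic))) : ℝ) : ℂ) ^ z ∂ν)‖ ^ 2 * ‖φ₀‖ ^ 2) ≤ (x₂ * (T : ℝ) ^ (2 * x₂) * Real.sqrt ((∫ x in {x : (AdeleRing (𝓞 L) L)ˣ | (IdeleClassGroup.ideleNorm L x : ℝ) ≤ 1} ∩ 𝓕I,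 (IdeleClassGroup.ideleNorm L x : ℝ) ∂νI) * μK.real Set.univ * ‖φ₀‖ ^ 2) / η + Real.sqrt (x₂ ^ 2 * (T : ℝ) ^ (4 * x₂) * ((∫ x in {x : (AdeleRing (𝓞 L) L)ˣ | (IdeleClassGroup.ideleNorm L x : ℝ) ≤ 1} ∩ 𝓕I, (IdeleClassGroup.ideleNorm L x : ℝ) ∂νI) * μK.real Set.univ * ‖φ₀‖ ^ 2) / η ^ 2 + ((∫ x in {x : (AdeleRing (𝓞 L) L)ˣ | (IdeleClassGroup.ideleNorm L x : ℝ) ≤ 1} ∩ 𝓕I, (IdeleClassGroup.ideleNorm L x : ℝ) ∂νI) * μK.real Set.univ * ‖φ₀‖ ^ 2) * (T : ℝ) ^ (4 * x₂))) ^ 2) ∧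
      (|z.im| ≤ 1 → ((∫ x in {x : (AdeleRing (𝓞 L) L)ˣ | (IdeleClassGroup.ideleNorm L x : ℝ) ≤ 1} ∩ 𝓕I, (IdeleClassGroup.ideleNorm L x : ℝ) ∂νI) * μK.real Set.univ * ‖(∫ v : ↥(adelicUnipotent (↥(maximalRealSubfield L)) L (IsCMField.complexConj L) 3), (((borelHeight ((quasiSplit (↥(maximalRealSubfield L)) L (IsCMField.complexConj L) 3).toAdelic (weylLongU ((IsCMField.complexConj L : L ≃ₐ[↥(maximalRealSubfield L)] L) : L →+* L) (rfl : (StdForm.antidiagonal 3).over L = (StdForm.antidiagonal 3).over L)) * (v : (quasiSplit (↥(maximalRealSubfield L)) L (IsCMField.complexConj L) 3).Adelic))) : ℝ) : ℂ) ^ z ∂ν)‖ ^ 2 * ‖φ₀‖ ^ 2) ≤ ((z.re - 1) * (T : ℝ) ^ (2 * (z.re - 1)) * Real.sqrt ((∫ x in {x : (AdeleRing (𝓞 L) L)ˣ | (IdeleClassGroup.ideleNorm L x : ℝ) ≤ 1} ∩ 𝓕I, (IdeleClassGroup.ideleNorm L x : ℝ) ∂νI) * μK.real Set.univ * ‖φ₀‖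 ^ 2) +
        Real.sqrt ((z.re - 1) ^ 2 * (T : ℝ) ^ (4 * (z.re - 1)) * ((∫ x in {x : (AdeleRing (𝓞 L) L)ˣ | (IdeleClassGroup.ideleNorm L x : ℝ) ≤ 1} ∩ 𝓕I, (IdeleClassGroup.ideleNorm L x : ℝ) ∂νI) * μK.real Set.univ * ‖φ₀‖ ^ 2) + ((∫ x in {x : (AdeleRing (𝓞 L) L)ˣ | (IdeleClassGroup.ideleNorm L x : ℝ) ≤ 1} ∩ 𝓕I, (IdeleClassGroup.ideleNorm L x : ℝ) ∂νI) * μK.real Set.univ * ‖φ₀‖ ^ 2) * (T : ℝ) ^ (4 * (z.re - 1)))) ^ 2 / z.im ^ 2) :=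
  poleControl_sphericalEisenstein_cm_three_of_archSmooth L μ νG μK νI h𝓕I ν h𝓕N h𝓕1 h𝓕c hβ hT hφ₀ hz hy hc hcδ hδ μF hm
    fun R => K2E1HeightLineArchSmoothU3E.exists_archSmoothZ_flatSectionU_const_cm_three_uniform L hc hcδ hδ μF φ₀ m R

/-- **POLE CONTROL AT THE SPHERICAL VECTOR OF `U(2,1)` OVER A CM FIELD ON THE GODEMENT HALF-PLANE — UNCONDITIONAL, NO LETTERS.**  For a CM field `L`, an automorphic measure `μ`,
Haar measures `ν_G, μ_K, ν_I, ν` with the fundamental-domain data `𝓕_I, 𝓕`, a covering weight `β`, `T ≥ 1`, `φ₀ ≠ 0` and `z` with `Re z > 2`, `Im z ≠ 0`: the truncated spherical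
Eisenstein series `Λ^T E(f_z)`, `f_z = φ₀·H^z` on `U(2,1)(𝔸_{L⁺})`, satisfies (a1) the Maass–Selberg square-norm bound, (a2) its local uniformity on `x₁ ≤ Re z − 1 ≤ x₂`, `|Im z| ≥ η`,
and (a3) the `|Im z| ≤ 1` bound — verbatim ★ p858209 `poleControl_sphericalEisenstein_cm_three` (a1) ∧ (a2) ∧ (a3), with EVERY survivor of the campaign discharged: `hdec′`∕`hdecU` by
★ (R3u)₃ + ★ (q11) (§2–§3), `hφarchZ` by ★ (E-d), and the letters (`c² = 1` from `IsCMField.complexConj_apply_apply`, `δ = x − x̄ ≠ 0` from `IsCMField.complexConj_ne_one`,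
`μ_F = Measure.addHaar` on the Borel `𝔸_{L⁺}`, `m = [L:ℚ] + 1`) chosen inside the proof.  CEILING NOT CLAIMED: this is IV.3.12 (a) for the scalar `c`-function on the Godement
range, not the meromorphic continuation. [cite: MoeglinWaldspurger1995, IV.2.3 and IV.3.12 (a)] [cite: Arthur1980TraceFormulaII, §4] [cite: Garrett2018, §1.12 and §11.3] -/
theorem poleControl_sphericalEisenstein_cm_three_unconditional
    (μ : Measure (quasiSplit (↥(maximalRealSubfield L)) L (IsCMField.complexConj L) 3).automorphicQuotient) [(quasiSplit (↥(maximalRealSubfield L)) L (IsCMField.complexConj L) 3).IsAutomorphicMeasure μ]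
    (νG : Measure (quasiSplit (↥(maximalRealSubfield L)) L (IsCMField.complexConj L) 3).Adelic) [νG.IsHaarMeasure] [νG.IsInvInvariant]
    (μK : Measure ((standardMaximalCompactGL 3 L).comap (adelicVal (↥(maximalRealSubfield L)) L (IsCMField.complexConj L) 3 ((StdForm.antidiagonal 3).over L)) : Subgroup (quasiSplit (↥(maximalRealSubfield L)) L (IsCMField.complexConj L) 3).Adelic))
    [μK.IsHaarMeasure]
    (νI : Measure (AdeleRing (𝓞 L) L)ˣ) [νI.IsHaarMeasure]
    {𝓕I : Set (AdeleRing (𝓞 L) L)ˣ} (h𝓕I : IsIdeleClassDomain L 𝓕I)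
    (ν : Measure ↥(adelicUnipotent (↥(maximalRealSubfield L)) L (IsCMField.complexConj L) 3)) [ν.IsHaarMeasure] [ν.IsInvInvariant]
    {𝓕 : Set ↥(adelicUnipotent (↥(maximalRealSubfield L)) L (IsCMField.complexConj L) 3)} (h𝓕N : IsFundamentalDomain ↥(rationalUnipotent (↥(maximalRealSubfield L)) L (IsCMField.complexConj L) 3) 𝓕 ν) (h𝓕1 : ν 𝓕 = 1) (h𝓕c : IsCompact (closure 𝓕))
    {β : (quasiSplit (↥(maximalRealSubfield L)) L (IsCMField.complexConj L) 3).Adelic → ℝ≥0∞} (hβ : IsCoveringWeight ((arithmeticBorel (↥(maximalRealSubfield L)) L (IsCMField.complexConj L) 3).map (quasiSplit (↥(maximalRealSubfield L)) L (IsCMField.complexConj L) 3).arithmeticSubgroup.subtype) β)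
    {T : ℝ≥0} (hT : 1 ≤ T) {φ₀ : ℂ} (hφ₀ : φ₀ ≠ 0) {z : ℂ} (hz : 2 < z.re) (hy : z.im ≠ 0) :
    Real.sqrt ((∫ x in {x : (AdeleRing (𝓞 L) L)ˣ | (IdeleClassGroup.ideleNorm L x : ℝ) ≤ 1} ∩ 𝓕I, (IdeleClassGroup.ideleNorm L x : ℝ) ∂νI) * μK.real Set.univ * ‖(∫ v : ↥(adelicUnipotent (↥(maximalRealSubfield L)) L (IsCMField.complexConj L) 3), (((borelHeight ((quasiSplit (↥(maximalRealSubfield L)) L (IsCMField.complexConj L) 3).toAdelic (weylLongU ((IsCMField.complexConj L : L ≃ₐ[↥(maximalRealSubfield L)] L) : L →+* L) (rfl : (StdForm.antidiagonal 3).over L = (StdForm.antidiagonal 3).over L)) * (v : (quasiSplit (↥(maximalRealSubfield L)) L (IsCMField.complexConj L) 3).Adelic))) : ℝ) : ℂ) ^ z ∂ν)‖ ^ 2 * ‖φ₀‖ ^ 2) ≤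
        (z.re - 1) * (T : ℝ) ^ (2 * (z.re - 1)) * Real.sqrt ((∫ x in {x : (AdeleRing (𝓞 L) L)ˣ | (IdeleClassGroup.ideleNorm L x : ℝ) ≤ 1} ∩ 𝓕I, (IdeleClassGroup.ideleNorm L x : ℝ) ∂νI) * μK.real Set.univ * ‖φ₀‖ ^ 2) / |z.im| +
          Real.sqrt ((z.re - 1) ^ 2 * (T : ℝ) ^ (4 * (z.re - 1)) * ((∫ x in {x : (AdeleRing (𝓞 L) L)ˣ | (IdeleClassGroup.ideleNorm L x : ℝ) ≤ 1} ∩ 𝓕I, (IdeleClassGroup.ideleNorm L x : ℝ) ∂νI) * μK.real Set.univ * ‖φ₀‖ ^ 2) / z.im ^ 2 + ((∫ x in {x : (AdeleRing (𝓞 L) L)ˣ | (IdeleClassGroup.ideleNorm L x : ℝ) ≤ 1} ∩ 𝓕I, (IdeleClassGroup.ideleNorm L x : ℝ) ∂νI) * μK.real Set.univ * ‖φ₀‖ ^ 2) * (T : ℝ) ^ (4 * (z.re - 1))) ∧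
      (∀ {x₁ x₂ η : ℝ}, 0 < x₁ → z.re - 1 ∈ Set.Icc x₁ x₂ → 0 < η → η ≤ |z.im| →
        ((∫ x in {x : (AdeleRing (𝓞 L) L)ˣ | (IdeleClassGroup.ideleNorm L x : ℝ) ≤ 1} ∩ 𝓕I, (IdeleClassGroup.ideleNorm L x : ℝ) ∂νI) * μK.real Set.univ * ‖(∫ v : ↥(adelicUnipotent (↥(maximalRealSubfield L)) L (IsCMField.complexConj L) 3), (((borelHeight ((quasiSplit (↥(maximalRealSubfield L)) L (IsCMField.complexConj L) 3).toAdelic (weylLongU ((IsCMField.complexConj L : L ≃ₐ[↥(maximalRealSubfield L)] L) : L →+* L) (rfl : (StdForm.antidiagonal 3).over L = (StdForm.antidiagonal 3).over L)) * (v : (quasiSplit (↥(maximalRealSubfield L)) L (IsCMField.complexConj L) 3).Adelic))) : ℝ) : ℂ) ^ z ∂ν)‖ ^ 2 * ‖φ₀‖ ^ 2) ≤ (x₂ * (T : ℝ) ^ (2 * x₂) * Real.sqrt ((∫ x in {x : (AdeleRing (𝓞 L) L)ˣ | (IdeleClassGroup.ideleNorm L x : ℝ) ≤ 1} ∩ 𝓕I,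 (IdeleClassGroup.ideleNorm L x : ℝ) ∂νI) * μK.real Set.univ * ‖φ₀‖ ^ 2) / η + Real.sqrt (x₂ ^ 2 * (T : ℝ) ^ (4 * x₂) * ((∫ x in {x : (AdeleRing (𝓞 L) L)ˣ | (IdeleClassGroup.ideleNorm L x : ℝ) ≤ 1} ∩ 𝓕I, (IdeleClassGroup.ideleNorm L x : ℝ) ∂νI) * μK.real Set.univ * ‖φ₀‖ ^ 2) / η ^ 2 + ((∫ x in {x : (AdeleRing (𝓞 L) L)ˣ | (IdeleClassGroup.ideleNorm L x : ℝ) ≤ 1} ∩ 𝓕I, (IdeleClassGroup.ideleNorm L x : ℝ) ∂νI) * μK.real Set.univ * ‖φ₀‖ ^ 2) * (T : ℝ) ^ (4 * x₂))) ^ 2) ∧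
      (|z.im| ≤ 1 → ((∫ x in {x : (AdeleRing (𝓞 L) L)ˣ | (IdeleClassGroup.ideleNorm L x : ℝ) ≤ 1} ∩ 𝓕I, (IdeleClassGroup.ideleNorm L x : ℝ) ∂νI) * μK.real Set.univ * ‖(∫ v : ↥(adelicUnipotent (↥(maximalRealSubfield L)) L (IsCMField.complexConj L) 3), (((borelHeight ((quasiSplit (↥(maximalRealSubfield L)) L (IsCMField.complexConj L) 3).toAdelic (weylLongU ((IsCMField.complexConj L : L ≃ₐ[↥(maximalRealSubfield L)] L) : L →+* L) (rfl : (StdForm.antidiagonal 3).over L = (StdForm.antidiagonal 3).over L)) * (v : (quasiSplit (↥(maximalRealSubfield L)) L (IsCMField.complexConj L) 3).Adelic))) : ℝ) : ℂ) ^ z ∂ν)‖ ^ 2 * ‖φ₀‖ ^ 2) ≤ ((z.re - 1) * (T : ℝ) ^ (2 * (z.re - 1)) * Real.sqrt ((∫ x in {x : (AdeleRing (𝓞 L) L)ˣ | (IdeleClassGroup.ideleNorm L x : ℝ) ≤ 1} ∩ 𝓕I, (IdeleClassGroup.ideleNorm L x : ℝ) ∂νI) * μK.real Set.univ * ‖φ₀‖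 ^ 2) +
        Real.sqrt ((z.re - 1) ^ 2 * (T : ℝ) ^ (4 * (z.re - 1)) * ((∫ x in {x : (AdeleRing (𝓞 L) L)ˣ | (IdeleClassGroup.ideleNorm L x : ℝ) ≤ 1} ∩ 𝓕I, (IdeleClassGroup.ideleNorm L x : ℝ) ∂νI) * μK.real Set.univ * ‖φ₀‖ ^ 2) + ((∫ x in {x : (AdeleRing (𝓞 L) L)ˣ | (IdeleClassGroup.ideleNorm L x : ℝ) ≤ 1} ∩ 𝓕I, (IdeleClassGroup.ideleNorm L x : ℝ) ∂νI) * μK.real Set.univ * ‖φ₀‖ ^ 2) * (T : ℝ) ^ (4 * (z.re - 1)))) ^ 2 / z.im ^ 2) := by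
  -- the letters of the discharge, chosen here: `c² = 1`, a trace-zero `δ ∈ L⁻ ∖ 0`, the Borel structure and an additive Haar measure on `𝔸_{L⁺}`, the order `m = [L:ℚ] + 1`
  have hc : IsCMField.complexConj L * IsCMField.complexConj L = 1 :=
    AlgEquiv.ext fun y => by rw [AlgEquiv.mul_apply, AlgEquiv.one_apply, IsCMField.complexConj_apply_apply]
  obtain ⟨δ, hδ, hcδ⟩ : ∃ δ : L, δ ≠ 0 ∧ IsCMField.complexConj L δ = -δ := by
    obtain ⟨x, hx⟩ : ∃ x : L, IsCMField.complexConj L x ≠ x := by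
      by_contra h
      exact IsCMField.complexConj_ne_one (K := L) (AlgEquiv.ext fun x => not_not.1 fun hx => h ⟨x, hx⟩)
    exact ⟨x - IsCMField.complexConj L x, sub_ne_zero.2 (Ne.symm hx), by rw [map_sub, IsCMField.complexConj_apply_apply, neg_sub]⟩
  letI : MeasurableSpace (AdeleRing (𝓞 ↥(maximalRealSubfield L)) ↥(maximalRealSubfield L)) := borel _
  haveI : BorelSpace (AdeleRing (𝓞 ↥(maximalRealSubfield L)) ↥(maximalRealSubfield L)) := ⟨rfl⟩
  haveI := locallyCompactSpace_adeleRing' ↥(maximalRealSubfield L)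
  exact poleControl_sphericalEisenstein_cm_three_of_letters L μ νG μK νI h𝓕I ν h𝓕N h𝓕1 h𝓕c hβ hT hφ₀ hz hy hc hcδ hδ
    (Measure.addHaar : Measure (AdeleRing (𝓞 ↥(maximalRealSubfield L)) ↥(maximalRealSubfield L))) (m := Module.finrank ℚ L + 1) (by exact_mod_cast Nat.lt_succ_self _)

end Summit.HodgeConjecture.HodgeConjecture.Cruxes.H413.K2E1MaassSelbergPoleControlSphericalCMThreeArch

end
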